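import Mathlib
import HarnessLib
import Summits.HubbardSuperconductivity.HubbardSuperconductivity.Theorems.ChiralWindowCwKLChiralWindowD4Invariant
import Summits.HubbardSuperconductivity.HubbardSuperconductivity.Theorems.WeakCouplingBCSKlCertTPrimePHReflectionMeasure

/-!
# Route `WeakCouplingBCS` — the point group `D₄` preserves the Fermi-curve measure of EVERY `t`–`t′` band at EVERY level
# (located input S3 of «(KLSCAN)-TPRIME-SOUNDNESS», certificate half of stmt-HubbardSuperconductivity-0158; cell gate-hubbard-kl, seat p4 g19)

The registered leaf `stub_klD4Invariant` (…ChiralWindowCwKLChiralWindowD4Invariant) proves `D₄`-invariance of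
`σ = fermiCurveMeasure (squareDispersion 1 0) μ` for `μ ∈ (-4, 0)` only: there the Fermi curve lies in the OPEN square `(-π, π)²`,
which `D₄` preserves, whereas the half-open zone `brillouinZone = [-π, π)²` is not `D₄`-invariant.  This file removes both restrictions:

* **`klph_d4_measurePreserving (tp μ : ℝ) (γ : DihedralGroup 4) :
    MeasurePreserving (d4Momentum γ) (fermiCurveMeasure (squareDispersion 1 tp) μ) (fermiCurveMeasure (squareDispersion 1 tp) μ)`**
  — every `t′`, every `μ`, no hypothesis.

Proof.  `ε_{t′}` and the Fermi speed `‖∇ε_{t′}‖` are exactly `D₄`-invariant (§1, from the explicit gradient `klph_gradient_squareDispersion`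
of …PHReflectionMeasure).  The Fermi-curve measure coincides with the same density `‖∇ε‖⁻¹ · μH[1]` carried by the CLOSED-box level set
`{|k₀| ≤ π, |k₁| ≤ π, ε_{t′} = μ}` (§3, `klph_fermiCurveMeasure_eq_closed`): the difference lives on the two boundary lines `kᵢ = π`, and a line
`kᵢ = c` with `sin c = 0` meets a level set of `ε_{t′}` either in a countable set (arc length has no atoms) or, in the degenerate case
`1 + 2t′ cos c = 0`, along a segment on which `∇ε_{t′}` vanishes identically, so that the density `‖∇ε‖⁻¹` is Lean's `0⁻¹ = 0` (§2).  The closed box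
IS `D₄`-invariant, so the abstract rows `kl_d4_measurePreserving_hausdorff` / `kl_d4_measurePreserving_withDensity` of the `t′ = 0` file apply (§3),
and `d4Momentum (r i) = rotⁱ`, `d4Momentum (sr i) = refl ∘ rotⁱ` iterate.

No definitions.  Nothing here asserts a margin at any `t′`, a doping window, or superconductivity.
References: S. Raghu, S. A. Kivelson, D. J. Scalapino, Phys. Rev. B 81 (2010) 224505, §II (6), (8), §III (17).
-/

noncomputable section

-- the tree's namespace `Summit.<Summit>.<Problem>.Theorems` repeats the summit name by design (D-0017)
set_option linter.dupNamespace false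

namespace Summit.HubbardSuperconductivity.HubbardSuperconductivity.Theorems

open MeasureTheory Set Real Literature.MathematicalPhysics.QuantumLattice
open scoped ENNReal

/-! ### §1 `ε_{t′}` and its Fermi speed are `D₄`-invariant -/

/-- `ε_{t′} ∘ rot = ε_{t′}`. [folklore] -/
theorem klph_squareDispersion_rot (s : ℝ) (k : Momentum) :
    squareDispersion 1 s (rotMomentum k) = squareDispersion 1 s k := by
  simp only [squareDispersion, kl_d4_rot_apply_zero, kl_d4_rot_apply_one, Real.cos_neg]
  ring

/-- `ε_{t′} ∘ refl = ε_{t′}`. [folklore] -/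
theorem klph_squareDispersion_refl (s : ℝ) (k : Momentum) :
    squareDispersion 1 s (reflMomentum k) = squareDispersion 1 s k := by
  simp only [squareDispersion, kl_d4_refl_apply_zero, kl_d4_refl_apply_one, Real.cos_neg]

/-- The Fermi speed of the `t`–`t′` band is `rot`-invariant. [folklore] -/
theorem klph_speed_rot (s : ℝ) (k : Momentum) :
    ‖gradient (squareDispersion 1 s) (rotMomentum k)‖ = ‖gradient (squareDispersion 1 s) k‖ := by
  rw [klph_gradient_squareDispersion, klph_gradient_squareDispersion, kl_d4_norm_mk, kl_d4_norm_mk,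
    kl_d4_rot_apply_zero, kl_d4_rot_apply_one, Real.sin_neg, Real.cos_neg]
  congr 1
  ring

/-- The Fermi speed of the `t`–`t′` band is `refl`-invariant. [folklore] -/
theorem klph_speed_refl (s : ℝ) (k : Momentum) :
    ‖gradient (squareDispersion 1 s) (reflMomentum k)‖ = ‖gradient (squareDispersion 1 s) k‖ := by
  rw [klph_gradient_squareDispersion, klph_gradient_squareDispersion, kl_d4_norm_mk, kl_d4_norm_mk,
    kl_d4_refl_apply_zero, kl_d4_refl_apply_one, Real.sin_neg, Real.cos_neg]
  congr 1
  ring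

/-! ### §2 Lines `kᵢ = c` with `sin c = 0` carry no density -/

/-- On a line `k₀ = c` with `sin c = 0`, the level set `{ε_s = μ}` is either countable (then arc length is `0`) or — when
`1 + 2s cos c = 0` — a set on which `∇ε_s ≡ 0`; in both cases `∫ ‖∇ε_s‖⁻¹ dμH[1] = 0` over it. [folklore] -/
theorem klph_setLIntegral_density_line_fst (s μ c : ℝ) (hc : Real.sin c = 0) :
    ∫⁻ k in {k : Momentum | k 0 = c} ∩ {k | squareDispersion 1 s k = μ},
      ENNReal.ofReal (‖gradient (squareDispersion 1 s) k‖⁻¹) ∂(μH[1] : Measure Momentum) = 0 := by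
  haveI := Measure.nullSingletonClass_hausdorff Momentum (d := 1) one_pos
  have hc0 : Measurable fun k : Momentum => k 0 := (PiLp.continuous_apply 2 (fun _ : Fin 2 => ℝ) 0).measurable
  have hL : MeasurableSet ({k : Momentum | k 0 = c} ∩ {k | squareDispersion 1 s k = μ}) :=
    (hc0 (measurableSet_singleton c)).inter ((measurable_squareDispersion 1 s) (measurableSet_singleton μ))
  by_cases hA : 1 + 2 * s * cos c = 0
  · have hcongr : ∀ k ∈ {k : Momentum | k 0 = c} ∩ {k | squareDispersion 1 s k = μ},
        ENNReal.ofReal (‖gradient (squareDispersion 1 s) k‖⁻¹) = 0 := fun k hk => by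
      have hk0 : k 0 = c := hk.1
      rw [klph_gradient_squareDispersion, kl_d4_norm_mk, hk0]
      simp [hc, hA]
    rw [setLIntegral_congr_fun hL hcongr, lintegral_zero]
  · set d : ℝ := (-μ - 2 * cos c) / (2 * (1 + 2 * s * cos c)) with hd
    have hsub : {k : Momentum | k 0 = c} ∩ {k | squareDispersion 1 s k = μ} ⊆
        (fun y : ℝ => (WithLp.toLp 2 ![c, y] : Momentum)) '' {y : ℝ | cos y = d} := by
      rintro k ⟨hk0, hε⟩
      have hk0' : k 0 = c := hk0
      have hε' : squareDispersion 1 s k = μ := hε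
      refine ⟨k 1, ?_, ?_⟩
      · simp only [mem_setOf_eq, hd]
        rw [eq_div_iff (mul_ne_zero two_ne_zero hA)]
        simp only [squareDispersion, hk0'] at hε'
        linarith
      · ext i; fin_cases i <;> simp [hk0']
    have hnull : (μH[1] : Measure Momentum) ({k : Momentum | k 0 = c} ∩ {k | squareDispersion 1 s k = μ}) = 0 :=
      measure_mono_null hsub (((countable_setOf_cos_eq d).image _).measure_zero _)
    rw [Measure.restrict_eq_zero.2 hnull, lintegral_zero_measure]

/-- The same for the lines `k₁ = c` with `sin c = 0`. [folklore] -/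
theorem klph_setLIntegral_density_line_snd (s μ c : ℝ) (hc : Real.sin c = 0) :
    ∫⁻ k in {k : Momentum | k 1 = c} ∩ {k | squareDispersion 1 s k = μ},
      ENNReal.ofReal (‖gradient (squareDispersion 1 s) k‖⁻¹) ∂(μH[1] : Measure Momentum) = 0 := by
  haveI := Measure.nullSingletonClass_hausdorff Momentum (d := 1) one_pos
  have hc1 : Measurable fun k : Momentum => k 1 := (PiLp.continuous_apply 2 (fun _ : Fin 2 => ℝ) 1).measurable
  have hL : MeasurableSet ({k : Momentum | k 1 = c} ∩ {k | squareDispersion 1 s k = μ}) :=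
    (hc1 (measurableSet_singleton c)).inter ((measurable_squareDispersion 1 s) (measurableSet_singleton μ))
  by_cases hA : 1 + 2 * s * cos c = 0
  · have hcongr : ∀ k ∈ {k : Momentum | k 1 = c} ∩ {k | squareDispersion 1 s k = μ},
        ENNReal.ofReal (‖gradient (squareDispersion 1 s) k‖⁻¹) = 0 := fun k hk => by
      have hk1 : k 1 = c := hk.1
      rw [klph_gradient_squareDispersion, kl_d4_norm_mk, hk1]
      simp [hc, hA]
    rw [setLIntegral_congr_fun hL hcongr, lintegral_zero]
  · set d : ℝ := (-μ - 2 * cos c) / (2 * (1 + 2 * s * cos c)) with hd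
    have hsub : {k : Momentum | k 1 = c} ∩ {k | squareDispersion 1 s k = μ} ⊆
        (fun y : ℝ => (WithLp.toLp 2 ![y, c] : Momentum)) '' {y : ℝ | cos y = d} := by
      rintro k ⟨hk1, hε⟩
      have hk1' : k 1 = c := hk1
      have hε' : squareDispersion 1 s k = μ := hε
      refine ⟨k 0, ?_, ?_⟩
      · simp only [mem_setOf_eq, hd]
        rw [eq_div_iff (mul_ne_zero two_ne_zero hA)]
        simp only [squareDispersion, hk1'] at hε'
        linarith
      · ext i; fin_cases i <;> simp [hk1']
    have hnull : (μH[1] : Measure Momentum) ({k : Momentum | k 1 = c} ∩ {k | squareDispersion 1 s k = μ}) = 0 :=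
      measure_mono_null hsub (((countable_setOf_cos_eq d).image _).measure_zero _)
    rw [Measure.restrict_eq_zero.2 hnull, lintegral_zero_measure]

/-! ### §3 The Fermi-curve measure as a density on the closed-box level set, and `D₄`-invariance -/

/-- The closed-box level set `{|k₀| ≤ π, |k₁| ≤ π, ε_s = μ}` is measurable (local spelling, no definition). [folklore] -/
theorem klph_measurableSet_closedFermi (s μ : ℝ) :
    MeasurableSet {k : Momentum | (∀ i, |k i| ≤ π) ∧ squareDispersion 1 s k = μ} := by
  have h1 : IsClosed {k : Momentum | ∀ i, |k i| ≤ π} := by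
    rw [show {k : Momentum | ∀ i, |k i| ≤ π} = ⋂ i, {k : Momentum | |k i| ≤ π} by ext k; simp]
    exact isClosed_iInter fun i =>
      isClosed_le (continuous_abs.comp (PiLp.continuous_apply 2 (fun _ : Fin 2 => ℝ) i)) continuous_const
  have h2 : IsClosed {k : Momentum | squareDispersion 1 s k = μ} := isClosed_eq (continuous_squareDispersion 1 s) continuous_const
  exact (h1.inter h2).measurableSet

/-- The closed-box level set is `rot`-invariant. [folklore] -/
theorem klph_rot_preimage_closedFermi (s μ : ℝ) :
    rotMomentum ⁻¹' {k : Momentum | (∀ i, |k i| ≤ π) ∧ squareDispersion 1 s k = μ} =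
      {k : Momentum | (∀ i, |k i| ≤ π) ∧ squareDispersion 1 s k = μ} := by
  ext k
  simp only [mem_preimage, mem_setOf_eq, Fin.forall_fin_two, kl_d4_rot_apply_zero, kl_d4_rot_apply_one, abs_neg,
    klph_squareDispersion_rot]
  tauto

/-- The closed-box level set is `refl`-invariant. [folklore] -/
theorem klph_refl_preimage_closedFermi (s μ : ℝ) :
    reflMomentum ⁻¹' {k : Momentum | (∀ i, |k i| ≤ π) ∧ squareDispersion 1 s k = μ} =
      {k : Momentum | (∀ i, |k i| ≤ π) ∧ squareDispersion 1 s k = μ} := by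
  ext k
  simp only [mem_preimage, mem_setOf_eq, Fin.forall_fin_two, kl_d4_refl_apply_zero, kl_d4_refl_apply_one, abs_neg,
    klph_squareDispersion_refl]

/-- The Fermi curve (half-open zone) lies in the closed-box level set. [folklore] -/
theorem klph_fermiCurve_subset_closedFermi (s μ : ℝ) :
    fermiCurve (squareDispersion 1 s) μ ⊆ {k : Momentum | (∀ i, |k i| ≤ π) ∧ squareDispersion 1 s k = μ} :=
  fun _ hk => ⟨fun i => abs_le.2 ⟨(hk.1 i).1, (hk.1 i).2.le⟩, hk.2⟩

/-- The closed-box level set exceeds the Fermi curve only on the two boundary lines `kᵢ = π`. [folklore] -/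
theorem klph_closedFermi_diff_subset (s μ : ℝ) :
    {k : Momentum | (∀ i, |k i| ≤ π) ∧ squareDispersion 1 s k = μ} \ fermiCurve (squareDispersion 1 s) μ ⊆
      ({k : Momentum | k 0 = π} ∩ {k | squareDispersion 1 s k = μ}) ∪
        ({k : Momentum | k 1 = π} ∩ {k | squareDispersion 1 s k = μ}) := by
  rintro k ⟨⟨hbox, hε⟩, hF⟩
  have hnot : ¬ (∀ i, k i ∈ Ico (-π) π) := fun h => hF ⟨h, hε⟩
  rw [Fin.forall_fin_two] at hnot
  have h0 := abs_le.1 (hbox 0)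
  have h1 := abs_le.1 (hbox 1)
  by_cases hk0 : k 0 = π
  · exact Or.inl ⟨hk0, hε⟩
  · right
    refine ⟨?_, hε⟩
    have hk0' : k 0 ∈ Ico (-π) π := ⟨h0.1, lt_of_le_of_ne h0.2 hk0⟩
    by_contra hk1
    exact hnot ⟨hk0', ⟨h1.1, lt_of_le_of_ne h1.2 hk1⟩⟩

/-- **The Fermi-curve measure is the density `‖∇ε‖⁻¹ · μH[1]` on the CLOSED-box level set** (the boundary lines `kᵢ = π` carry no
density, §2). [folklore] -/
theorem klph_fermiCurveMeasure_eq_closed (s μ : ℝ) :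
    fermiCurveMeasure (squareDispersion 1 s) μ =
      ((μH[1] : Measure Momentum).restrict {k : Momentum | (∀ i, |k i| ≤ π) ∧ squareDispersion 1 s k = μ}).withDensity
        fun k => ENNReal.ofReal (‖gradient (squareDispersion 1 s) k‖⁻¹) := by
  set Fc := {k : Momentum | (∀ i, |k i| ≤ π) ∧ squareDispersion 1 s k = μ} with hFc
  set F := fermiCurve (squareDispersion 1 s) μ with hF
  set ρ : Momentum → ℝ≥0∞ := fun k => ENNReal.ofReal (‖gradient (squareDispersion 1 s) k‖⁻¹) with hρ
  have hFm : MeasurableSet F := measurableSet_fermiCurve (measurable_squareDispersion 1 s) μ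
  have hFcm : MeasurableSet Fc := klph_measurableSet_closedFermi s μ
  have hsub : F ⊆ Fc := klph_fermiCurve_subset_closedFermi s μ
  -- the boundary part carries no density
  have hzero : ∫⁻ k in Fc \ F, ρ k ∂(μH[1] : Measure Momentum) = 0 := by
    refine nonpos_iff_eq_zero.1 ?_
    calc ∫⁻ k in Fc \ F, ρ k ∂(μH[1] : Measure Momentum)
        ≤ ∫⁻ k in ({k : Momentum | k 0 = π} ∩ {k | squareDispersion 1 s k = μ}) ∪
            ({k : Momentum | k 1 = π} ∩ {k | squareDispersion 1 s k = μ}), ρ k ∂(μH[1] : Measure Momentum) :=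
          lintegral_mono' (Measure.restrict_mono (klph_closedFermi_diff_subset s μ) le_rfl) le_rfl
      _ ≤ ∫⁻ k in {k : Momentum | k 0 = π} ∩ {k | squareDispersion 1 s k = μ}, ρ k ∂(μH[1] : Measure Momentum) +
            ∫⁻ k in {k : Momentum | k 1 = π} ∩ {k | squareDispersion 1 s k = μ}, ρ k ∂(μH[1] : Measure Momentum) :=
          lintegral_union_le _ _ _
      _ = 0 := by
          rw [hρ, klph_setLIntegral_density_line_fst s μ π Real.sin_pi, klph_setLIntegral_density_line_snd s μ π Real.sin_pi,
            add_zero]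
  unfold fermiCurveMeasure
  rw [← hF]
  refine Measure.ext fun A hA => ?_
  rw [withDensity_apply _ hA, withDensity_apply _ hA, Measure.restrict_restrict hA, Measure.restrict_restrict hA]
  have hsplit : A ∩ Fc = (A ∩ F) ∪ (A ∩ (Fc \ F)) := by
    rw [← inter_union_distrib_left, union_sdiff_cancel hsub]
  have hdisj : Disjoint (A ∩ F) (A ∩ (Fc \ F)) :=
    Disjoint.mono inter_subset_right inter_subset_right disjoint_sdiff_right
  rw [hsplit, Measure.restrict_union hdisj (hA.inter (hFcm.diff hFm)), lintegral_add_measure]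
  have h0 : ∫⁻ k in A ∩ (Fc \ F), ρ k ∂(μH[1] : Measure Momentum) = 0 :=
    nonpos_iff_eq_zero.1 ((lintegral_mono' (Measure.restrict_mono inter_subset_right le_rfl) le_rfl).trans hzero.le)
  rw [h0, add_zero]

/-- `rot` preserves the Fermi-curve measure of every `t`–`t′` band at every level. [folklore] -/
theorem klph_rot_measurePreserving (s μ : ℝ) :
    MeasurePreserving rotMomentum (fermiCurveMeasure (squareDispersion 1 s) μ) (fermiCurveMeasure (squareDispersion 1 s) μ) := by
  have h1 := (kl_d4_measurePreserving_hausdorff kl_d4_rot_isometry kl_d4_rot_surjective).restrict_preimage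
    (klph_measurableSet_closedFermi s μ)
  rw [klph_rot_preimage_closedFermi] at h1
  rw [klph_fermiCurveMeasure_eq_closed]
  exact kl_d4_measurePreserving_withDensity h1 (kl_d4_measurable_density _) (fun k => by rw [klph_speed_rot])

/-- `refl` preserves the Fermi-curve measure of every `t`–`t′` band at every level. [folklore] -/
theorem klph_refl_measurePreserving (s μ : ℝ) :
    MeasurePreserving reflMomentum (fermiCurveMeasure (squareDispersion 1 s) μ) (fermiCurveMeasure (squareDispersion 1 s) μ) := by
  have h1 := (kl_d4_measurePreserving_hausdorff kl_d4_refl_isometry kl_d4_refl_surjective).restrict_preimage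
    (klph_measurableSet_closedFermi s μ)
  rw [klph_refl_preimage_closedFermi] at h1
  rw [klph_fermiCurveMeasure_eq_closed]
  exact kl_d4_measurePreserving_withDensity h1 (kl_d4_measurable_density _) (fun k => by rw [klph_speed_refl])

/-- **«(KLSCAN)-TPRIME-D4»: the point group `D₄` preserves the Fermi-curve (density-of-states) measure of EVERY `t`–`t′` band at
EVERY chemical potential** — the `t′`-general, range-free twin of the registered leaf `stub_klD4Invariant`.
[cite: RaghuKivelsonScalapino2010, §II (6), (8) and §III (17)] -/
theorem klph_d4_measurePreserving (tp μ : ℝ) (γ : DihedralGroup 4) :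
    MeasurePreserving (d4Momentum γ) (fermiCurveMeasure (squareDispersion 1 tp) μ)
      (fermiCurveMeasure (squareDispersion 1 tp) μ) := by
  have hrot := klph_rot_measurePreserving tp μ
  have hrefl := klph_refl_measurePreserving tp μ
  cases γ with
  | r i =>
    have h : d4Momentum (DihedralGroup.r i) = rotMomentum^[i.val] := funext fun _ => rfl
    rw [h]
    exact hrot.iterate _
  | sr i =>
    have h : d4Momentum (DihedralGroup.sr i) = reflMomentum ∘ rotMomentum^[i.val] := funext fun _ => rfl
    rw [h]
    exact hrefl.comp (hrot.iterate _)

/-- The registered `t′ = 0` leaf without its `μ`-range: `D₄` preserves `σ[ε₀, μ]` for every `μ`. [folklore] -/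
theorem klph_d4_measurePreserving_zero (μ : ℝ) (γ : DihedralGroup 4) :
    MeasurePreserving (d4Momentum γ) (fermiCurveMeasure (squareDispersion 1 0) μ)
      (fermiCurveMeasure (squareDispersion 1 0) μ) :=
  klph_d4_measurePreserving 0 μ γ

end Summit.HubbardSuperconductivity.HubbardSuperconductivity.Theorems

end
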